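import Mathlib
import Summits.ValiantsHypothesis.ValiantsHypothesis.Theorems.KPlusLogSqLawTridiagonalRealStaticGapProductFour
import Summits.ValiantsHypothesis.ValiantsHypothesis.Theorems.KPlusLogSqLawTridiagonalRealStaticFaceRule
import Summits.ValiantsHypothesis.ValiantsHypothesis.Theorems.KPlusLogSqLawTridiagonalRealStaticSlopeSumRow

/-!
# The RATIO-TWO FACE LAW of the α register (all sizes): slopes `±1` and `±2` on two non-adjacent links are never sharp

An ALL-SIZES, MAGNITUDE-FREE sub-Descartes sector law for static symmetric tridiagonal monomial designs `(a, d, b, f)` (`a_j, b_j ≠ 0`;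
edge slopes `L_j = 2f_j − d_j − d_{j+1} ∈ ℤ`; `D_m = pathDet a d b f m`), from this lineage's ENS face rule (`faceRule_of_sharp`, p656498):

**`card_posRoots_add_two_le_card_matchings_of_slopes_one_two`** — if two NON-ADJACENT links `k`, `l` (`k + 2 ≤ l ≤ m − 2`) carry slopes
of absolute values `1` and `2` (in either order, any signs), then `Z(D_m) + 2 ≤ #matchings(P_m)` (`= F_{m+1}`): the design is NOT
Descartes–Fibonacci sharp, for every size `m`; lattice form `…_of_slopes_g_2g`: slopes `±g`, `±2g` when every slope is divisible by `g`
(`gapProduct_progression_four`: rescaling to the consecutive case).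

Mechanism.  The face `(∅; k, l)` has matching slope-sums `{0, L_k, L_l, L_k + L_l}` = four CONSECUTIVE integers `c, …, c+3`, extremes and
middles forming the two parallelogram pairs.  If the slope-sums are not injective on matchings, `Z + 2 ≤ #matchings` is the slope-sum row
(`card_posRoots_pathDet_le_slopeSum` with the envelope of matching sums, `card_posRoots_add_two_le_of_not_injOn`).  If they are injective and the
design were sharp, the face rule gives `W_c · W_{c+3} ≤ W_{c+1} · W_{c+2}` (`W_v = ∏_{v' ≠ v} |v − v'|` over the matching sums).  But every other
matching sum is an integer OUTSIDE `[c, c+3]`, at offset `j ≥ 1` beyond an extreme, contributing `j(j+3)` to the extremes and `(j+1)(j+2)` to the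
middles, while the four face points contribute `36` resp. `4`; distinct offsets on one side telescope,
`∏_{j ∈ S} (j+1)(j+2)/(j(j+3)) ≤ 3(N+1)/(N+3) < 3`, so `W_{c+1} W_{c+2} < 9 · 4 · ∏ j(j+3) = W_c W_{c+3}` —
contradiction (`gapProduct_consecutive_four` of `…TridiagonalRealStaticGapProductFour.lean`, an abstract lemma on finite sets of integers).

HONEST FRAMING: a thin all-sizes sector law (slopes exactly `±1, ±2` somewhere non-adjacent); B5 = 7, B6 ∈ [9, 12] and «α NO MOVER» unchanged;
nothing on `WeakLifting`/`TropicalB` in their windows, Conjecture B, the doors, `MatrixDescartes` (18050) or `VP ≠ VNP`.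
Seat: prover val-sym-lift-p2 g18, `--supports stmt-ValiantsHypothesis-19561`.
-/

set_option linter.dupNamespace false
set_option autoImplicit false

namespace Summit.ValiantsHypothesis.ValiantsHypothesis.Theorems.KPlusLogSqLaw

namespace EdgeNormalForm

open Polynomial Finset
open Summit.ValiantsHypothesis.ValiantsHypothesis.Theorems.KPlusLogSqLaw.StaticTridiagonalRealPotential (pathDet)
open Summit.ValiantsHypothesis.ValiantsHypothesis.Theorems.KPlusLogSqLaw.SlopeSumRow (card_posRoots_pathDet_le_slopeSum)

/-! ## 1. Non-injective matching sums: the slope-sum row leaves a gap of two -/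

variable (a : ℕ → ℝ) (d : ℕ → ℕ) (b : ℕ → ℝ) (f : ℕ → ℕ)

/-- **Coincident matching slope-sums cost a root**: if two distinct matchings of the path `P_m` have the same integer slope-sum, then
`Z(D_m) + 2 ≤ #matchings(P_m)` (the slope-sum row `card_posRoots_pathDet_le_slopeSum` with the envelope of matching sums). [this work] -/
theorem card_posRoots_add_two_le_of_coincidence (m : ℕ) {N N' : Finset ℕ}
    (hN : N ∈ (range (m - 1)).powerset.filter (fun M : Finset ℕ => ∀ j ∈ M, j + 1 ∉ M))
    (hN' : N' ∈ (range (m - 1)).powerset.filter (fun M : Finset ℕ => ∀ j ∈ M, j + 1 ∉ M)) (hne : N ≠ N')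
    (hsum : ∑ j ∈ N, (2 * (f j : ℤ) - d j - d (j + 1)) = ∑ j ∈ N', (2 * (f j : ℤ) - d j - d (j + 1))) :
    ((pathDet a d b f m).roots.toFinset.filter (fun x => 0 < x)).card + 2 ≤
      ((range (m - 1)).powerset.filter (fun M : Finset ℕ => ∀ j ∈ M, j + 1 ∉ M)).card := by
  -- the envelope of matching slope-sums
  set zs : Finset ℕ → ℤ := fun M => ∑ j ∈ M, (2 * (f j : ℤ) - d j - d (j + 1)) with hzs
  set S : ℕ → Finset ℤ := fun n =>
    ((range (n - 1)).powerset.filter (fun M : Finset ℕ => ∀ j ∈ M, j + 1 ∉ M)).image zs with hS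
  have hempty : ∀ n, (∅ : Finset ℕ) ∈ (range n).powerset.filter (fun M : Finset ℕ => ∀ j ∈ M, j + 1 ∉ M) :=
    fun n => by simp
  have h0 : (0 : ℤ) ∈ S 0 := Finset.mem_image.mpr ⟨∅, hempty _, by simp [hzs]⟩
  have h1 : (0 : ℤ) ∈ S 1 := Finset.mem_image.mpr ⟨∅, hempty _, by simp [hzs]⟩
  have hMt_mono : ∀ n n', n ≤ n' → (range n).powerset.filter (fun M : Finset ℕ => ∀ j ∈ M, j + 1 ∉ M) ⊆
      (range n').powerset.filter (fun M : Finset ℕ => ∀ j ∈ M, j + 1 ∉ M) := by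
    intro n n' hnn' M hM
    simp only [Finset.mem_filter, Finset.mem_powerset] at hM ⊢
    exact ⟨hM.1.trans (Finset.range_mono hnn'), hM.2⟩
  have hmono : ∀ n, n + 2 ≤ m → S (n + 1) ⊆ S (n + 2) := fun n _ =>
    Finset.image_subset_image (hMt_mono _ _ (by omega))
  have hstep : ∀ n, n + 2 ≤ m → ∀ s ∈ S n, s + (2 * (f n : ℤ) - d n - d (n + 1)) ∈ S (n + 2) := by
    intro n _ s hs
    obtain ⟨M, hM, rfl⟩ := Finset.mem_image.mp hs
    simp only [Finset.mem_filter, Finset.mem_powerset] at hM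
    have hnM : n ∉ M := fun h => by have := Finset.mem_range.mp (hM.1 h); omega
    refine Finset.mem_image.mpr ⟨insert n M, ?_, ?_⟩
    · simp only [Finset.mem_filter, Finset.mem_powerset, show n + 2 - 1 = n + 1 from rfl]
      refine ⟨?_, ?_⟩
      · intro j hj
        rcases Finset.mem_insert.mp hj with rfl | hj
        · exact Finset.mem_range.mpr (by omega)
        · have := Finset.mem_range.mp (hM.1 hj); exact Finset.mem_range.mpr (by omega)
      · intro j hj hj1
        rcases Finset.mem_insert.mp hj with rfl | hj
        · rcases Finset.mem_insert.mp hj1 with h | h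
          · omega
          · have := Finset.mem_range.mp (hM.1 h); omega
        · rcases Finset.mem_insert.mp hj1 with h | h
          · have := Finset.mem_range.mp (hM.1 hj); omega
          · exact hM.2 j hj h
    · simp only [hzs]
      rw [Finset.sum_insert hnM]; ring
  have hrow := card_posRoots_pathDet_le_slopeSum a d b f S m h0 h1 hmono hstep
  -- `#(S m) + 1 ≤ #matchings` because `N`, `N'` collide
  have hN'e : N' ∈ ((range (m - 1)).powerset.filter (fun M : Finset ℕ => ∀ j ∈ M, j + 1 ∉ M)).erase N :=
    Finset.mem_erase.mpr ⟨hne.symm, hN'⟩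
  have hsub : S m ⊆ (((range (m - 1)).powerset.filter (fun M : Finset ℕ => ∀ j ∈ M, j + 1 ∉ M)).erase N).image zs := by
    intro x hx
    obtain ⟨M, hM, rfl⟩ := Finset.mem_image.mp hx
    by_cases hMN : M = N
    · subst hMN; exact Finset.mem_image.mpr ⟨N', hN'e, hsum.symm⟩
    · exact Finset.mem_image.mpr ⟨M, Finset.mem_erase.mpr ⟨hMN, hM⟩, rfl⟩
  have hle := (Finset.card_le_card hsub).trans Finset.card_image_le
  rw [Finset.card_erase_of_mem hN] at hle
  have hpos : 1 ≤ ((range (m - 1)).powerset.filter (fun M : Finset ℕ => ∀ j ∈ M, j + 1 ∉ M)).card :=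
    Finset.card_pos.mpr ⟨N, hN⟩
  have hSpos : 1 ≤ (S m).card := Finset.card_pos.mpr ⟨zs N, Finset.mem_image.mpr ⟨N, hN, rfl⟩⟩
  omega

/-! ## 2. Arithmetic progressions of step `g`: rescaling the consecutive case -/

/-- **Four-term progressions beat the face rule** when every label lies on the same lattice `c + gℤ`: rescale by `g` and apply
`gapProduct_consecutive_four`. [this work] -/
theorem gapProduct_progression_four {ι : Type*} [DecidableEq ι] (Act : Finset ι) (z : ι → ℤ)
    (hinj : ∀ P ∈ Act, ∀ Q ∈ Act, z P = z Q → P = Q) (c g : ℤ) (hg : 0 < g) (hmod : ∀ Q ∈ Act, g ∣ z Q - c)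
    {E₁ M₁ M₂ E₂ : ι} (hE₁ : E₁ ∈ Act) (hM₁ : M₁ ∈ Act) (hM₂ : M₂ ∈ Act) (hE₂ : E₂ ∈ Act)
    (zE₁ : z E₁ = c) (zM₁ : z M₁ = c + g) (zM₂ : z M₂ = c + 2 * g) (zE₂ : z E₂ = c + 3 * g) :
    (∏ Q ∈ Act.erase M₁, |((z M₁ : ℝ)) - z Q|) * (∏ Q ∈ Act.erase M₂, |((z M₂ : ℝ)) - z Q|) <
      (∏ Q ∈ Act.erase E₁, |((z E₁ : ℝ)) - z Q|) * (∏ Q ∈ Act.erase E₂, |((z E₂ : ℝ)) - z Q|) := by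
  -- the rescaled labelling
  set z' : ι → ℤ := fun Q => (z Q - c) / g with hz'
  have hzz' : ∀ Q ∈ Act, z Q = c + g * z' Q := fun Q hQ => by
    have := Int.ediv_mul_cancel (hmod Q hQ); simp only [hz']; linarith [this]
  have hinj' : ∀ P ∈ Act, ∀ Q ∈ Act, z' P = z' Q → P = Q := fun P hP Q hQ h =>
    hinj P hP Q hQ (by rw [hzz' P hP, hzz' Q hQ, h])
  have hg0 : (g : ℤ) ≠ 0 := ne_of_gt hg
  have v1 : z' E₁ = 0 := by simp only [hz', zE₁, sub_self, Int.zero_ediv]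
  have v2 : z' M₁ = 0 + 1 := by simp only [hz', zM₁, add_sub_cancel_left, Int.ediv_self hg0, zero_add]
  have v3 : z' M₂ = 0 + 2 := by simp only [hz', zM₂, add_sub_cancel_left, Int.mul_ediv_cancel _ hg0, zero_add]
  have v4 : z' E₂ = 0 + 3 := by simp only [hz', zE₂, add_sub_cancel_left, Int.mul_ediv_cancel _ hg0, zero_add]
  have key := gapProduct_consecutive_four Act z' hinj' 0 hE₁ hM₁ hM₂ hE₂ v1 v2 v3 v4
  -- each gap rescales by `g`
  have hresc : ∀ P ∈ Act, ∏ Q ∈ Act.erase P, |((z P : ℝ)) - z Q| = (g : ℝ) ^ (Act.erase P).card * ∏ Q ∈ Act.erase P, |((z' P : ℝ)) - z' Q| := by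
    intro P hP
    rw [Finset.pow_card_mul_prod]
    refine Finset.prod_congr rfl fun Q hQ => ?_
    rw [hzz' P hP, hzz' Q (Finset.mem_of_mem_erase hQ)]
    push_cast
    rw [show ((c : ℝ) + g * (z' P) - (c + g * (z' Q))) = g * ((z' P : ℝ) - z' Q) by ring, abs_mul,
      abs_of_pos (by exact_mod_cast hg : (0 : ℝ) < g)]
  have hcardP : ∀ P ∈ Act, (Act.erase P).card = Act.card - 1 := fun P hP => Finset.card_erase_of_mem hP
  rw [hresc M₁ hM₁, hresc M₂ hM₂, hresc E₁ hE₁, hresc E₂ hE₂, hcardP M₁ hM₁, hcardP M₂ hM₂, hcardP E₁ hE₁, hcardP E₂ hE₂]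
  have hgpos : (0 : ℝ) < (g : ℝ) ^ (Act.card - 1) := pow_pos (by exact_mod_cast hg) _
  nlinarith [mul_pos hgpos hgpos, key]

/-! ## 3. The ratio-two face law -/

/-- **THE RATIO-TWO FACE LAW (all sizes, lattice form).**  A static symmetric tridiagonal monomial design with `a_j, b_j ≠ 0` whose edge slopes
`L_j = 2f_j − d_j − d_{j+1}` (`j + 2 ≤ m`) are all divisible by `g ≥ 1`, with two NON-ADJACENT links `k + 2 ≤ l ≤ m − 2` carrying slopes of
absolute values `g` and `2g` (either order, any signs), is never Descartes–Fibonacci sharp: `Z(D_m) + 2 ≤ #matchings(P_m)`. [this work] -/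
theorem card_posRoots_add_two_le_card_matchings_of_slopes_g_2g (m k l g : ℕ) (ha : ∀ j, a j ≠ 0) (hb : ∀ j, b j ≠ 0)
    (hg : 1 ≤ g) (hdiv : ∀ j, j + 2 ≤ m → (g : ℤ) ∣ 2 * (f j : ℤ) - d j - d (j + 1))
    (hkl : k + 2 ≤ l) (hlm : l + 2 ≤ m)
    (h12 : ((2 * (f k : ℤ) - d k - d (k + 1)).natAbs = g ∧ (2 * (f l : ℤ) - d l - d (l + 1)).natAbs = 2 * g) ∨
      ((2 * (f k : ℤ) - d k - d (k + 1)).natAbs = 2 * g ∧ (2 * (f l : ℤ) - d l - d (l + 1)).natAbs = g)) :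
    ((pathDet a d b f m).roots.toFinset.filter (fun x => 0 < x)).card + 2 ≤
      ((range (m - 1)).powerset.filter (fun M : Finset ℕ => ∀ j ∈ M, j + 1 ∉ M)).card := by
  by_contra hcon
  rw [not_le] at hcon
  -- integer slope-sums and the data of `faceRule_of_sharp`
  set zs : Finset ℕ → ℤ := fun M => ∑ j ∈ M, (2 * (f j : ℤ) - d j - d (j + 1)) with hzs
  set S : Finset (Finset ℕ) := (range (m - 1)).powerset with hSdef
  rw [hSdef] at hcon
  set σ : ↥S → ℝ := fun M => ∑ j ∈ (M : Finset ℕ), (2 * (f j : ℝ) - d j - d (j + 1)) with hσ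
  set z : ↥S → ℤ := fun M => zs (M : Finset ℕ) with hz
  have hσz : ∀ M : ↥S, σ M = ((z M : ℤ) : ℝ) := fun M => by simp only [hσ, hz, hzs]; push_cast; rfl
  set Act : Finset ↥S := Finset.univ.filter fun (M : ↥S) => ∀ j ∈ (M : Finset ℕ), j + 1 ∉ (M : Finset ℕ) with hAct
  have hActmap : Act.map (Function.Embedding.subtype _) =
      (range (m - 1)).powerset.filter (fun M : Finset ℕ => ∀ j ∈ M, j + 1 ∉ M) := by
    ext N
    rw [Finset.mem_map, Finset.mem_filter, Finset.mem_powerset]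
    constructor
    · rintro ⟨M, hM, rfl⟩
      exact ⟨Finset.mem_powerset.mp (by rw [← hSdef]; exact M.2), (Finset.mem_filter.mp hM).2⟩
    · rintro ⟨hN, hP⟩
      exact ⟨⟨N, by rw [hSdef]; exact Finset.mem_powerset.mpr hN⟩, Finset.mem_filter.mpr ⟨Finset.mem_univ _, hP⟩, rfl⟩
  have hmemAct : ∀ M : ↥S, M ∈ Act ↔ ∀ j ∈ (M : Finset ℕ), j + 1 ∉ (M : Finset ℕ) := fun M => by
    simp only [hAct, Finset.mem_filter, Finset.mem_univ, true_and]
  have hcardAct : Act.card = ((range (m - 1)).powerset.filter (fun M : Finset ℕ => ∀ j ∈ M, j + 1 ∉ M)).card := by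
    rw [← hActmap, Finset.card_map]
  have hsharp : Act.card ≤ ((pathDet a d b f m).roots.toFinset.filter fun x => 0 < x).card + 1 := by
    rw [hcardAct]; omega
  -- injectivity of the slope-sums on matchings (else the slope-sum row contradicts `hcon`)
  have hinj : ∀ M ∈ Act, ∀ M' ∈ Act, σ M = σ M' → M = M' := by
    intro M hM M' hM' h
    by_contra hMM'
    have hval : (M : Finset ℕ) ≠ (M' : Finset ℕ) := fun e => hMM' (Subtype.ext e)
    have hMf : (M : Finset ℕ) ∈ (range (m - 1)).powerset.filter (fun M : Finset ℕ => ∀ j ∈ M, j + 1 ∉ M) :=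
      Finset.mem_filter.mpr ⟨by rw [← hSdef]; exact M.2, (hmemAct M).mp hM⟩
    have hM'f : (M' : Finset ℕ) ∈ (range (m - 1)).powerset.filter (fun M : Finset ℕ => ∀ j ∈ M, j + 1 ∉ M) :=
      Finset.mem_filter.mpr ⟨by rw [← hSdef]; exact M'.2, (hmemAct M').mp hM'⟩
    have hzz : zs M = zs M' := by
      have : ((zs M : ℤ) : ℝ) = ((zs M' : ℤ) : ℝ) := by rw [← hσz M, ← hσz M']; exact h
      exact_mod_cast this
    have := card_posRoots_add_two_le_of_coincidence a d b f m hMf hM'f hval hzz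
    omega
  have hinjz : ∀ M ∈ Act, ∀ M' ∈ Act, z M = z M' → M = M' := fun M hM M' hM' h =>
    hinj M hM M' hM' (by rw [hσz, hσz, h])
  -- every matching slope-sum is divisible by `g`
  have hmodz : ∀ M ∈ Act, (g : ℤ) ∣ z M - 0 := by
    intro M _
    rw [sub_zero]
    refine Finset.dvd_sum fun j hj => hdiv j ?_
    have := Finset.mem_range.mp (Finset.mem_powerset.mp (by rw [← hSdef]; exact M.2) hj)
    omega
  -- the face `(∅; k, l)`
  have hkl' : k ≠ l := by omega
  have me : (∅ : Finset ℕ) ∈ S := by rw [hSdef]; exact Finset.mem_powerset.mpr (Finset.empty_subset _)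
  have mk : ({k} : Finset ℕ) ∈ S := by
    rw [hSdef, Finset.mem_powerset, Finset.singleton_subset_iff, Finset.mem_range]; omega
  have ml : ({l} : Finset ℕ) ∈ S := by
    rw [hSdef, Finset.mem_powerset, Finset.singleton_subset_iff, Finset.mem_range]; omega
  have mkl : ({k, l} : Finset ℕ) ∈ S := by
    rw [hSdef, Finset.mem_powerset, Finset.insert_subset_iff, Finset.singleton_subset_iff, Finset.mem_range, Finset.mem_range]
    omega
  have Ae : (⟨∅, me⟩ : ↥S) ∈ Act := (hmemAct _).mpr (by simp)
  have Ak : (⟨{k}, mk⟩ : ↥S) ∈ Act := (hmemAct _).mpr (by simp)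
  have Al : (⟨{l}, ml⟩ : ↥S) ∈ Act := (hmemAct _).mpr (by simp)
  have Akl : (⟨{k, l}, mkl⟩ : ↥S) ∈ Act := (hmemAct _).mpr (by
    intro j hj
    simp only [Finset.mem_insert, Finset.mem_singleton] at hj ⊢
    omega)
  -- integer values on the face
  set u : ℤ := 2 * (f k : ℤ) - d k - d (k + 1) with hu
  set v : ℤ := 2 * (f l : ℤ) - d l - d (l + 1) with hv
  have ze : z ⟨∅, me⟩ = 0 := by simp [hz, hzs]
  have zk : z ⟨{k}, mk⟩ = u := by simp [hz, hzs, hu]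
  have zl : z ⟨{l}, ml⟩ = v := by simp [hz, hzs, hv]
  have zkl : z ⟨{k, l}, mkl⟩ = u + v := by
    simp only [hz, hzs, hu, hv]
    rw [Finset.sum_pair hkl']
  -- coefficient moduli of the four face matchings
  set gq : ℕ → ℝ := fun j => b j ^ 2 / |a j * a (j + 1)| with hgq
  have pe : ∏ j ∈ (∅ : Finset ℕ), gq j = 1 := Finset.prod_empty
  have pk : ∏ j ∈ ({k} : Finset ℕ), gq j = gq k := Finset.prod_singleton _ _
  have pl : ∏ j ∈ ({l} : Finset ℕ), gq j = gq l := Finset.prod_singleton _ _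
  have pkl : ∏ j ∈ ({k, l} : Finset ℕ), gq j = gq k * gq l := Finset.prod_pair hkl'
  -- the core: a face whose values form a 4-term progression of step `g` on the lattice `gℤ` contradicts the face rule
  have hg' : (0 : ℤ) < g := by exact_mod_cast hg
  have core : ∀ (E₁ M₁ M₂ E₂ : ↥S) (c : ℤ), E₁ ∈ Act → M₁ ∈ Act → M₂ ∈ Act → E₂ ∈ Act →
      z E₁ = c → z M₁ = c + g → z M₂ = c + 2 * g → z E₂ = c + 3 * g →
      (∏ j ∈ (E₁ : Finset ℕ), gq j) * (∏ j ∈ (E₂ : Finset ℕ), gq j) =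
        (∏ j ∈ (M₁ : Finset ℕ), gq j) * (∏ j ∈ (M₂ : Finset ℕ), gq j) → False := by
    intro E₁ M₁ M₂ E₂ c hE₁ hM₁ hM₂ hE₂ zE₁ zM₁ zM₂ zE₂ hcoef
    have hgR : (0 : ℝ) < g := by exact_mod_cast hg
    have key := faceRule_of_sharp a d b f m ha hb σ rfl Act rfl hinj hsharp hE₁ hM₁ hM₂ hE₂
      (by rw [hσz, hσz, zE₁, zM₁]; push_cast; linarith)
      (by rw [hσz, hσz, zM₁, zM₂]; push_cast; linarith)
      (by rw [hσz, hσz, zM₂, zE₂]; push_cast; linarith)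
      (by rw [hσz, hσz, hσz, hσz, zE₁, zM₁, zM₂, zE₂]; push_cast; ring)
      hcoef
    simp_rw [hσz] at key
    have hmodc : ∀ Q ∈ Act, (g : ℤ) ∣ z Q - c := fun Q hQ => by
      have h1 := hmodz Q hQ
      have h2 := hmodz E₁ hE₁
      rw [sub_zero] at h1 h2
      rw [← zE₁]
      exact dvd_sub h1 h2
    exact absurd key (not_le.mpr (gapProduct_progression_four Act z hinjz c g hg' hmodc hE₁ hM₁ hM₂ hE₂ zE₁ zM₁ zM₂ zE₂))
  -- the eight sign cases
  rcases h12 with ⟨hua, hva⟩ | ⟨hua, hva⟩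
  · have hu2 : u = g ∨ u = -g := by omega
    have hv2 : v = 2 * g ∨ v = -(2 * g) := by omega
    rcases hu2 with hu1 | hu1 <;> rcases hv2 with hv1 | hv1
    · exact core ⟨∅, me⟩ ⟨{k}, mk⟩ ⟨{l}, ml⟩ ⟨{k, l}, mkl⟩ 0 Ae Ak Al Akl
        (by omega) (by omega) (by omega) (by omega) (by
          show (∏ j ∈ (∅ : Finset ℕ), gq j) * (∏ j ∈ ({k, l} : Finset ℕ), gq j) =
            (∏ j ∈ ({k} : Finset ℕ), gq j) * (∏ j ∈ ({l} : Finset ℕ), gq j)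
          rw [pkl, pe, pk, pl]; ring)
    · exact core ⟨{l}, ml⟩ ⟨{k, l}, mkl⟩ ⟨∅, me⟩ ⟨{k}, mk⟩ (-(2 * g)) Al Akl Ae Ak
        (by omega) (by omega) (by omega) (by omega) (by
          show (∏ j ∈ ({l} : Finset ℕ), gq j) * (∏ j ∈ ({k} : Finset ℕ), gq j) =
            (∏ j ∈ ({k, l} : Finset ℕ), gq j) * (∏ j ∈ (∅ : Finset ℕ), gq j)
          rw [pkl, pe, pk, pl]; ring)
    · exact core ⟨{k}, mk⟩ ⟨∅, me⟩ ⟨{k, l}, mkl⟩ ⟨{l}, ml⟩ (-g) Ak Ae Akl Al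
        (by omega) (by omega) (by omega) (by omega) (by
          show (∏ j ∈ ({k} : Finset ℕ), gq j) * (∏ j ∈ ({l} : Finset ℕ), gq j) =
            (∏ j ∈ (∅ : Finset ℕ), gq j) * (∏ j ∈ ({k, l} : Finset ℕ), gq j)
          rw [pkl, pe, pk, pl]; ring)
    · exact core ⟨{k, l}, mkl⟩ ⟨{l}, ml⟩ ⟨{k}, mk⟩ ⟨∅, me⟩ (-(3 * g)) Akl Al Ak Ae
        (by omega) (by omega) (by omega) (by omega) (by
          show (∏ j ∈ ({k, l} : Finset ℕ), gq j) * (∏ j ∈ (∅ : Finset ℕ), gq j) =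
            (∏ j ∈ ({l} : Finset ℕ), gq j) * (∏ j ∈ ({k} : Finset ℕ), gq j)
          rw [pkl, pe, pk, pl]; ring)
  · have hu2 : u = 2 * g ∨ u = -(2 * g) := by omega
    have hv2 : v = g ∨ v = -g := by omega
    rcases hu2 with hu1 | hu1 <;> rcases hv2 with hv1 | hv1
    · exact core ⟨∅, me⟩ ⟨{l}, ml⟩ ⟨{k}, mk⟩ ⟨{k, l}, mkl⟩ 0 Ae Al Ak Akl
        (by omega) (by omega) (by omega) (by omega) (by
          show (∏ j ∈ (∅ : Finset ℕ), gq j) * (∏ j ∈ ({k, l} : Finset ℕ), gq j) =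
            (∏ j ∈ ({l} : Finset ℕ), gq j) * (∏ j ∈ ({k} : Finset ℕ), gq j)
          rw [pkl, pe, pk, pl]; ring)
    · exact core ⟨{l}, ml⟩ ⟨∅, me⟩ ⟨{k, l}, mkl⟩ ⟨{k}, mk⟩ (-g) Al Ae Akl Ak
        (by omega) (by omega) (by omega) (by omega) (by
          show (∏ j ∈ ({l} : Finset ℕ), gq j) * (∏ j ∈ ({k} : Finset ℕ), gq j) =
            (∏ j ∈ (∅ : Finset ℕ), gq j) * (∏ j ∈ ({k, l} : Finset ℕ), gq j)
          rw [pkl, pe, pk, pl]; ring)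
    · exact core ⟨{k}, mk⟩ ⟨{k, l}, mkl⟩ ⟨∅, me⟩ ⟨{l}, ml⟩ (-(2 * g)) Ak Akl Ae Al
        (by omega) (by omega) (by omega) (by omega) (by
          show (∏ j ∈ ({k} : Finset ℕ), gq j) * (∏ j ∈ ({l} : Finset ℕ), gq j) =
            (∏ j ∈ ({k, l} : Finset ℕ), gq j) * (∏ j ∈ (∅ : Finset ℕ), gq j)
          rw [pkl, pe, pk, pl]; ring)
    · exact core ⟨{k, l}, mkl⟩ ⟨{k}, mk⟩ ⟨{l}, ml⟩ ⟨∅, me⟩ (-(3 * g)) Akl Ak Al Ae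
        (by omega) (by omega) (by omega) (by omega) (by
          show (∏ j ∈ ({k, l} : Finset ℕ), gq j) * (∏ j ∈ (∅ : Finset ℕ), gq j) =
            (∏ j ∈ ({k} : Finset ℕ), gq j) * (∏ j ∈ ({l} : Finset ℕ), gq j)
          rw [pkl, pe, pk, pl]; ring)

/-- **THE RATIO-TWO FACE LAW (all sizes)** — the primitive case `g = 1`: slopes of absolute values `1` and `2` on two non-adjacent links are never
Descartes–Fibonacci sharp, for every size and all magnitudes. [this work] -/
theorem card_posRoots_add_two_le_card_matchings_of_slopes_one_two (m k l : ℕ) (ha : ∀ j, a j ≠ 0) (hb : ∀ j, b j ≠ 0)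
    (hkl : k + 2 ≤ l) (hlm : l + 2 ≤ m)
    (h12 : ((2 * (f k : ℤ) - d k - d (k + 1)).natAbs = 1 ∧ (2 * (f l : ℤ) - d l - d (l + 1)).natAbs = 2) ∨
      ((2 * (f k : ℤ) - d k - d (k + 1)).natAbs = 2 ∧ (2 * (f l : ℤ) - d l - d (l + 1)).natAbs = 1)) :
    ((pathDet a d b f m).roots.toFinset.filter (fun x => 0 < x)).card + 2 ≤
      ((range (m - 1)).powerset.filter (fun M : Finset ℕ => ∀ j ∈ M, j + 1 ∉ M)).card :=
  card_posRoots_add_two_le_card_matchings_of_slopes_g_2g a d b f m k l 1 ha hb le_rfl (fun j _ => one_dvd _) hkl hlm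
    (by simpa using h12)

/-- **m = 6**: such designs have `Z(D_6) ≤ 11` (one below the Fibonacci count `F_7 − 1 = 12`; the register's upper value `B6 ≤ 12` is not
attained on this sector). [this work] -/
theorem card_posRoots_six_le_eleven_of_slopes_one_two (k l : ℕ) (ha : ∀ j, a j ≠ 0) (hb : ∀ j, b j ≠ 0)
    (hkl : k + 2 ≤ l) (hl : l ≤ 4)
    (h12 : ((2 * (f k : ℤ) - d k - d (k + 1)).natAbs = 1 ∧ (2 * (f l : ℤ) - d l - d (l + 1)).natAbs = 2) ∨
      ((2 * (f k : ℤ) - d k - d (k + 1)).natAbs = 2 ∧ (2 * (f l : ℤ) - d l - d (l + 1)).natAbs = 1)) :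
    ((pathDet a d b f 6).roots.toFinset.filter (fun x => 0 < x)).card ≤ 11 := by
  have h := card_posRoots_add_two_le_card_matchings_of_slopes_one_two a d b f 6 k l ha hb hkl (by omega) h12
  have h13 : ((range (6 - 1)).powerset.filter (fun M : Finset ℕ => ∀ j ∈ M, j + 1 ∉ M)).card = 13 := by decide
  omega

/-- **m = 7**: such designs have `Z(D_7) ≤ 19 < F_8 − 1 = 20`. [this work] -/
theorem card_posRoots_seven_le_nineteen_of_slopes_one_two (k l : ℕ) (ha : ∀ j, a j ≠ 0) (hb : ∀ j, b j ≠ 0)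
    (hkl : k + 2 ≤ l) (hl : l ≤ 5)
    (h12 : ((2 * (f k : ℤ) - d k - d (k + 1)).natAbs = 1 ∧ (2 * (f l : ℤ) - d l - d (l + 1)).natAbs = 2) ∨
      ((2 * (f k : ℤ) - d k - d (k + 1)).natAbs = 2 ∧ (2 * (f l : ℤ) - d l - d (l + 1)).natAbs = 1)) :
    ((pathDet a d b f 7).roots.toFinset.filter (fun x => 0 < x)).card ≤ 19 := by
  have h := card_posRoots_add_two_le_card_matchings_of_slopes_one_two a d b f 7 k l ha hb hkl (by omega) h12
  have h21 : ((range (7 - 1)).powerset.filter (fun M : Finset ℕ => ∀ j ∈ M, j + 1 ∉ M)).card = 21 := by decide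
  omega

end EdgeNormalForm

end Summit.ValiantsHypothesis.ValiantsHypothesis.Theorems.KPlusLogSqLaw
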